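import Summits.Ventures.DiscreteObjects.UnitDistance.FieldPlanes
import HarnessLib

/-!
# Every 4-colouring of `K²` (`√3, √5 ∈ K`) has a monochromatic `√3`-pair — Haugland's assembly step in field form (cell `pub-namedobj`, target (U), seat udg g21)

Framing (verbatim for the cell): lottery ticket; floor = certified bounds/negative ranges.

Haugland (arXiv:2608.04542, §3) turns a unit-distance graph in which the pair `(0,0), (0,√3)` is NON-monochromatic for `k = 4`
into a 5-chromatic unit-distance graph: two rotated copies make a pair at distance `2` monochromatic (the side-`2` triangle with its
medial unit triangle: the medial triangle takes three colours, each outer vertex is adjacent to two of them and at distance `√3` from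
the third), and Heule's rotation `θ₄ = (7 + i√15)/8` about `(−1,0)` maps `(1,0)` to `Y = (3/4, √15/4)`, again at distance `2` from
`(−1,0)` but at distance `1` from `(1,0)`.  Everything except the gadget lives in `ℚ(√3, √5)`.  This file records the step as a
statement about the FIELD PLANE `K²` for any real field `K ∋ √3, √5`: every proper `4`-colouring of the unit-distance graph on `K²`
makes one of the four `√3`-pairs `(P₁,M₂), (P₂,M₃), (P₁,N₂), (Y,N₃)` of an explicit 10-point configuration monochromatic
(`exists_monochromatic_sqrt3_pair`; 15 unit distances and 4 distances `√3`, each an identity in `ℚ(√3,√5)` certified by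
`linear_combination` over `(√3)² = 3`, `(√5)² = 5`).  Use (THEORY-U21 of the cell): a non-monochromatic-`√3`-pair gadget over an
admissible field `K ⊂ ℚ₁₁` with `√3, √5 ∈ K` would give `χ(K²) = 5` (`not_colorable_four_plane_of_sqrt3_pairs_bichromatic`) and hence
`χ(ℚ₁₁²) = 5`; no such gadget is known (Haugland's 740-vertex `G₁` lives over the heptagonal field, not inside `ℚ₁₁`).
Replication-grade (the argument is Haugland's); the field-plane form and its role for `ℚ₁₁` are ours.  Nothing here is cited as a fact.
-/

noncomputable section

namespace Summit.Ventures.DiscreteObjects.UnitDistance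

open SimpleGraph IntermediateField

namespace Sqrt3Pair

/-- The real number `a + b√3 + c√5 + d√3√5` with rational `a, b, c, d` (an element of `ℚ(√3, √5)`). -/
def cK (a b c d : ℚ) : ℝ := (a : ℝ) + (b : ℝ) * Real.sqrt 3 + (c : ℝ) * Real.sqrt 5 + (d : ℝ) * (Real.sqrt 3 * Real.sqrt 5)

/-- `cK a b c d ∈ K` whenever `√3, √5 ∈ K`. -/
theorem cK_mem (K : IntermediateField ℚ ℝ) (h3 : Real.sqrt 3 ∈ K) (h5 : Real.sqrt 5 ∈ K) (a b c d : ℚ) : cK a b c d ∈ K := by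
  have hq : ∀ r : ℚ, (r : ℝ) ∈ K := fun r => SubfieldClass.ratCast_mem K r
  unfold cK
  exact add_mem (add_mem (add_mem (hq a) (mul_mem (hq b) h3)) (mul_mem (hq c) h5)) (mul_mem (hq d) (mul_mem h3 h5))

/-- The ten points: `M₁M₂M₃` is the medial unit triangle of the side-2 triangle on `P₁ = (−1,0)`, `P₂ = (1,0)`; `N₁N₂N₃` that of the
side-2 triangle on `P₁` and `Y = (−1,0) + 2θ₄ = (3/4, √15/4)` (coordinates via `cK`). -/
def M₁ : EuclideanSpace ℝ (Fin 2) := !₂[cK 0 0 0 0, cK 0 0 0 0]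
/-- see `M₁` -/
def M₂ : EuclideanSpace ℝ (Fin 2) := !₂[cK (1/2) 0 0 0, cK 0 (1/2) 0 0]
/-- see `M₁` -/
def M₃ : EuclideanSpace ℝ (Fin 2) := !₂[cK (-1/2) 0 0 0, cK 0 (1/2) 0 0]
/-- see `M₁` -/
def P₁ : EuclideanSpace ℝ (Fin 2) := !₂[cK (-1) 0 0 0, cK 0 0 0 0]
/-- see `M₁` -/
def P₂ : EuclideanSpace ℝ (Fin 2) := !₂[cK 1 0 0 0, cK 0 0 0 0]
/-- see `M₁` -/
def Y : EuclideanSpace ℝ (Fin 2) := !₂[cK (3/4) 0 0 0, cK 0 0 0 (1/4)]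
/-- see `M₁` -/
def N₁ : EuclideanSpace ℝ (Fin 2) := !₂[cK (-1/8) 0 0 0, cK 0 0 0 (1/8)]
/-- see `M₁` -/
def N₂ : EuclideanSpace ℝ (Fin 2) := !₂[cK (5/16) 0 (-3/16) 0, cK 0 (7/16) 0 (3/16)]
/-- see `M₁` -/
def N₃ : EuclideanSpace ℝ (Fin 2) := !₂[cK (-9/16) 0 (-3/16) 0, cK 0 (7/16) 0 (1/16)]

/-- `dist = 1` between explicit points from the squared coordinate differences. -/
theorem dist_mk_eq_one {a b c d : ℝ} (h : (a - c) ^ 2 + (b - d) ^ 2 = 1) : dist !₂[a, b] !₂[c, d] = 1 := by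
  have hd : dist !₂[a, b] !₂[c, d] ^ 2 = 1 := by
    rw [EuclideanSpace.dist_sq_eq, Fin.sum_univ_two, Real.dist_eq, Real.dist_eq, sq_abs, sq_abs]
    simpa using h
  exact (pow_eq_one_iff_of_nonneg dist_nonneg two_ne_zero).1 hd

/-- `dist = √3` between explicit points from the squared coordinate differences. -/
theorem dist_mk_eq_sqrt3 {a b c d : ℝ} (h : (a - c) ^ 2 + (b - d) ^ 2 = 3) : dist !₂[a, b] !₂[c, d] = Real.sqrt 3 := by
  have hd : dist !₂[a, b] !₂[c, d] ^ 2 = 3 := by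
    rw [EuclideanSpace.dist_sq_eq, Fin.sum_univ_two, Real.dist_eq, Real.dist_eq, sq_abs, sq_abs]
    simpa using h
  rw [← hd, Real.sqrt_sq dist_nonneg]

/-- `dist M₁ M₂ = 1`. -/
theorem du0 : dist M₁ M₂ = 1 := by
  unfold M₁ M₂
  refine dist_mk_eq_one ?_
  simp only [cK]; push_cast
  have s3 : Real.sqrt 3 ^ 2 = 3 := Real.sq_sqrt (by norm_num)
  have s5 : Real.sqrt 5 ^ 2 = 5 := Real.sq_sqrt (by norm_num)
  linear_combination ((1/4 : ℝ)) * s3 + (0 : ℝ) * s5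

/-- `dist M₁ M₃ = 1`. -/
theorem du1 : dist M₁ M₃ = 1 := by
  unfold M₁ M₃
  refine dist_mk_eq_one ?_
  simp only [cK]; push_cast
  have s3 : Real.sqrt 3 ^ 2 = 3 := Real.sq_sqrt (by norm_num)
  have s5 : Real.sqrt 5 ^ 2 = 5 := Real.sq_sqrt (by norm_num)
  linear_combination ((1/4 : ℝ)) * s3 + (0 : ℝ) * s5

/-- `dist M₂ M₃ = 1`. -/
theorem du2 : dist M₂ M₃ = 1 := by
  unfold M₂ M₃
  refine dist_mk_eq_one ?_
  simp only [cK]; push_cast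
  have s3 : Real.sqrt 3 ^ 2 = 3 := Real.sq_sqrt (by norm_num)
  have s5 : Real.sqrt 5 ^ 2 = 5 := Real.sq_sqrt (by norm_num)
  linear_combination (0 : ℝ) * s3 + (0 : ℝ) * s5

/-- `dist P₁ M₁ = 1`. -/
theorem du3 : dist P₁ M₁ = 1 := by
  unfold P₁ M₁
  refine dist_mk_eq_one ?_
  simp only [cK]; push_cast
  have s3 : Real.sqrt 3 ^ 2 = 3 := Real.sq_sqrt (by norm_num)
  have s5 : Real.sqrt 5 ^ 2 = 5 := Real.sq_sqrt (by norm_num)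
  linear_combination (0 : ℝ) * s3 + (0 : ℝ) * s5

/-- `dist P₁ M₃ = 1`. -/
theorem du4 : dist P₁ M₃ = 1 := by
  unfold P₁ M₃
  refine dist_mk_eq_one ?_
  simp only [cK]; push_cast
  have s3 : Real.sqrt 3 ^ 2 = 3 := Real.sq_sqrt (by norm_num)
  have s5 : Real.sqrt 5 ^ 2 = 5 := Real.sq_sqrt (by norm_num)
  linear_combination ((1/4 : ℝ)) * s3 + (0 : ℝ) * s5

/-- `dist P₂ M₁ = 1`. -/
theorem du5 : dist P₂ M₁ = 1 := by
  unfold P₂ M₁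
  refine dist_mk_eq_one ?_
  simp only [cK]; push_cast
  have s3 : Real.sqrt 3 ^ 2 = 3 := Real.sq_sqrt (by norm_num)
  have s5 : Real.sqrt 5 ^ 2 = 5 := Real.sq_sqrt (by norm_num)
  linear_combination (0 : ℝ) * s3 + (0 : ℝ) * s5

/-- `dist P₂ M₂ = 1`. -/
theorem du6 : dist P₂ M₂ = 1 := by
  unfold P₂ M₂
  refine dist_mk_eq_one ?_
  simp only [cK]; push_cast
  have s3 : Real.sqrt 3 ^ 2 = 3 := Real.sq_sqrt (by norm_num)
  have s5 : Real.sqrt 5 ^ 2 = 5 := Real.sq_sqrt (by norm_num)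
  linear_combination ((1/4 : ℝ)) * s3 + (0 : ℝ) * s5

/-- `dist N₁ N₂ = 1`. -/
theorem du7 : dist N₁ N₂ = 1 := by
  unfold N₁ N₂
  refine dist_mk_eq_one ?_
  simp only [cK]; push_cast
  have s3 : Real.sqrt 3 ^ 2 = 3 := Real.sq_sqrt (by norm_num)
  have s5 : Real.sqrt 5 ^ 2 = 5 := Real.sq_sqrt (by norm_num)
  linear_combination ((49/256 : ℝ) + (7/128 : ℝ) * Real.sqrt 5 + (1/256 : ℝ) * Real.sqrt 5 ^ 2) * s3 + ((3/64 : ℝ)) * s5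

/-- `dist N₁ N₃ = 1`. -/
theorem du8 : dist N₁ N₃ = 1 := by
  unfold N₁ N₃
  refine dist_mk_eq_one ?_
  simp only [cK]; push_cast
  have s3 : Real.sqrt 3 ^ 2 = 3 := Real.sq_sqrt (by norm_num)
  have s5 : Real.sqrt 5 ^ 2 = 5 := Real.sq_sqrt (by norm_num)
  linear_combination ((49/256 : ℝ) + (-7/128 : ℝ) * Real.sqrt 5 + (1/256 : ℝ) * Real.sqrt 5 ^ 2) * s3 + ((3/64 : ℝ)) * s5

/-- `dist N₂ N₃ = 1`. -/
theorem du9 : dist N₂ N₃ = 1 := by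
  unfold N₂ N₃
  refine dist_mk_eq_one ?_
  simp only [cK]; push_cast
  have s3 : Real.sqrt 3 ^ 2 = 3 := Real.sq_sqrt (by norm_num)
  have s5 : Real.sqrt 5 ^ 2 = 5 := Real.sq_sqrt (by norm_num)
  linear_combination ((1/64 : ℝ) * Real.sqrt 5 ^ 2) * s3 + ((3/64 : ℝ)) * s5

/-- `dist P₁ N₁ = 1`. -/
theorem du10 : dist P₁ N₁ = 1 := by
  unfold P₁ N₁
  refine dist_mk_eq_one ?_
  simp only [cK]; push_cast
  have s3 : Real.sqrt 3 ^ 2 = 3 := Real.sq_sqrt (by norm_num)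
  have s5 : Real.sqrt 5 ^ 2 = 5 := Real.sq_sqrt (by norm_num)
  linear_combination ((1/64 : ℝ) * Real.sqrt 5 ^ 2) * s3 + ((3/64 : ℝ)) * s5

/-- `dist P₁ N₃ = 1`. -/
theorem du11 : dist P₁ N₃ = 1 := by
  unfold P₁ N₃
  refine dist_mk_eq_one ?_
  simp only [cK]; push_cast
  have s3 : Real.sqrt 3 ^ 2 = 3 := Real.sq_sqrt (by norm_num)
  have s5 : Real.sqrt 5 ^ 2 = 5 := Real.sq_sqrt (by norm_num)
  linear_combination ((49/256 : ℝ) + (7/128 : ℝ) * Real.sqrt 5 + (1/256 : ℝ) * Real.sqrt 5 ^ 2) * s3 + ((3/64 : ℝ)) * s5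

/-- `dist Y N₁ = 1`. -/
theorem du12 : dist Y N₁ = 1 := by
  unfold Y N₁
  refine dist_mk_eq_one ?_
  simp only [cK]; push_cast
  have s3 : Real.sqrt 3 ^ 2 = 3 := Real.sq_sqrt (by norm_num)
  have s5 : Real.sqrt 5 ^ 2 = 5 := Real.sq_sqrt (by norm_num)
  linear_combination ((1/64 : ℝ) * Real.sqrt 5 ^ 2) * s3 + ((3/64 : ℝ)) * s5

/-- `dist Y N₂ = 1`. -/
theorem du13 : dist Y N₂ = 1 := by
  unfold Y N₂
  refine dist_mk_eq_one ?_
  simp only [cK]; push_cast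
  have s3 : Real.sqrt 3 ^ 2 = 3 := Real.sq_sqrt (by norm_num)
  have s5 : Real.sqrt 5 ^ 2 = 5 := Real.sq_sqrt (by norm_num)
  linear_combination ((49/256 : ℝ) + (-7/128 : ℝ) * Real.sqrt 5 + (1/256 : ℝ) * Real.sqrt 5 ^ 2) * s3 + ((3/64 : ℝ)) * s5

/-- `dist P₂ Y = 1`. -/
theorem du14 : dist P₂ Y = 1 := by
  unfold P₂ Y
  refine dist_mk_eq_one ?_
  simp only [cK]; push_cast
  have s3 : Real.sqrt 3 ^ 2 = 3 := Real.sq_sqrt (by norm_num)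
  have s5 : Real.sqrt 5 ^ 2 = 5 := Real.sq_sqrt (by norm_num)
  linear_combination ((1/16 : ℝ) * Real.sqrt 5 ^ 2) * s3 + ((3/16 : ℝ)) * s5

/-- `dist P₁ M₂ = √3`. -/
theorem ds0 : dist P₁ M₂ = Real.sqrt 3 := by
  unfold P₁ M₂
  refine dist_mk_eq_sqrt3 ?_
  simp only [cK]; push_cast
  have s3 : Real.sqrt 3 ^ 2 = 3 := Real.sq_sqrt (by norm_num)
  have s5 : Real.sqrt 5 ^ 2 = 5 := Real.sq_sqrt (by norm_num)
  linear_combination ((1/4 : ℝ)) * s3 + (0 : ℝ) * s5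

/-- `dist P₂ M₃ = √3`. -/
theorem ds1 : dist P₂ M₃ = Real.sqrt 3 := by
  unfold P₂ M₃
  refine dist_mk_eq_sqrt3 ?_
  simp only [cK]; push_cast
  have s3 : Real.sqrt 3 ^ 2 = 3 := Real.sq_sqrt (by norm_num)
  have s5 : Real.sqrt 5 ^ 2 = 5 := Real.sq_sqrt (by norm_num)
  linear_combination ((1/4 : ℝ)) * s3 + (0 : ℝ) * s5

/-- `dist P₁ N₂ = √3`. -/
theorem ds2 : dist P₁ N₂ = Real.sqrt 3 := by
  unfold P₁ N₂
  refine dist_mk_eq_sqrt3 ?_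
  simp only [cK]; push_cast
  have s3 : Real.sqrt 3 ^ 2 = 3 := Real.sq_sqrt (by norm_num)
  have s5 : Real.sqrt 5 ^ 2 = 5 := Real.sq_sqrt (by norm_num)
  linear_combination ((49/256 : ℝ) + (21/128 : ℝ) * Real.sqrt 5 + (9/256 : ℝ) * Real.sqrt 5 ^ 2) * s3 + ((9/64 : ℝ)) * s5

/-- `dist Y N₃ = √3`. -/
theorem ds3 : dist Y N₃ = Real.sqrt 3 := by
  unfold Y N₃
  refine dist_mk_eq_sqrt3 ?_
  simp only [cK]; push_cast
  have s3 : Real.sqrt 3 ^ 2 = 3 := Real.sq_sqrt (by norm_num)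
  have s5 : Real.sqrt 5 ^ 2 = 5 := Real.sq_sqrt (by norm_num)
  linear_combination ((49/256 : ℝ) + (-21/128 : ℝ) * Real.sqrt 5 + (9/256 : ℝ) * Real.sqrt 5 ^ 2) * s3 + ((9/64 : ℝ)) * s5

/-- All nine points used in the colour argument lie in `K²` as soon as `√3, √5 ∈ K`. -/
theorem mem_fieldPoints (K : IntermediateField ℚ ℝ) (h3 : Real.sqrt 3 ∈ K) (h5 : Real.sqrt 5 ∈ K) :
    M₁ ∈ fieldPoints K ∧ M₂ ∈ fieldPoints K ∧ M₃ ∈ fieldPoints K ∧ P₁ ∈ fieldPoints K ∧ P₂ ∈ fieldPoints K ∧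
    Y ∈ fieldPoints K ∧ N₁ ∈ fieldPoints K ∧ N₂ ∈ fieldPoints K ∧ N₃ ∈ fieldPoints K := by
  have hc := cK_mem K h3 h5
  refine ⟨?_, ?_, ?_, ?_, ?_, ?_, ?_, ?_, ?_⟩ <;> intro i <;> fin_cases i <;>
    simp [M₁, M₂, M₃, P₁, P₂, Y, N₁, N₂, N₃, hc]

/-- The colour bookkeeping on `Fin 4`: a triangle `m₁m₂m₃` and two further vertices `p, q`, each differing from all three `mᵢ`, get the
same (fourth) colour. -/
theorem fourth_colour (m1 m2 m3 p q : Fin 4) (h12 : m1 ≠ m2) (h13 : m1 ≠ m3) (h23 : m2 ≠ m3)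
    (hp1 : p ≠ m1) (hp2 : p ≠ m2) (hp3 : p ≠ m3) (hq1 : q ≠ m1) (hq2 : q ≠ m2) (hq3 : q ≠ m3) : p = q := by
  revert m1 m2 m3 p q
  decide

end Sqrt3Pair

open Sqrt3Pair in
/-- If every `√3`-pair of `K²` is bichromatic in a `4`-colouring `C` (`√3, √5 ∈ K`), contradiction: the medial triangles force
`C P₁ = C P₂` and `C P₁ = C Y`, but `P₂ ~ Y`. -/
theorem false_of_sqrt3_pairs_bichromatic (K : IntermediateField ℚ ℝ) (h3 : Real.sqrt 3 ∈ K) (h5 : Real.sqrt 5 ∈ K)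
    (C : (planeUnitDistanceGraph.induce (fieldPoints K)).Coloring (Fin 4))
    (h : ∀ p q : fieldPoints K, dist (p : EuclideanSpace ℝ (Fin 2)) q = Real.sqrt 3 → C p ≠ C q) : False := by
  obtain ⟨hM1, hM2, hM3, hP1, hP2, hY, hN1, hN2, hN3⟩ := mem_fieldPoints K h3 h5
  -- adjacency in the induced graph is `dist = 1`
  have adj : ∀ {p q : EuclideanSpace ℝ (Fin 2)} (hp : p ∈ fieldPoints K) (hq : q ∈ fieldPoints K), dist p q = 1 →
      C ⟨p, hp⟩ ≠ C ⟨q, hq⟩ := by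
    intro p q hp hq hd
    exact C.valid (show (planeUnitDistanceGraph.induce (fieldPoints K)).Adj ⟨p, hp⟩ ⟨q, hq⟩ from hd)
  have e12 : C ⟨P₁, hP1⟩ = C ⟨P₂, hP2⟩ :=
    fourth_colour _ _ _ _ _ (adj hM1 hM2 du0) (adj hM1 hM3 du1) (adj hM2 hM3 du2) (adj hP1 hM1 du3) (h ⟨P₁, hP1⟩ ⟨M₂, hM2⟩ ds0) (adj hP1 hM3 du4)
      (adj hP2 hM1 du5) (adj hP2 hM2 du6) (h ⟨P₂, hP2⟩ ⟨M₃, hM3⟩ ds1)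
  have e1y : C ⟨P₁, hP1⟩ = C ⟨Y, hY⟩ :=
    fourth_colour _ _ _ _ _ (adj hN1 hN2 du7) (adj hN1 hN3 du8) (adj hN2 hN3 du9) (adj hP1 hN1 du10) (h ⟨P₁, hP1⟩ ⟨N₂, hN2⟩ ds2) (adj hP1 hN3 du11)
      (adj hY hN1 du12) (adj hY hN2 du13) (h ⟨Y, hY⟩ ⟨N₃, hN3⟩ ds3)
  exact adj hP2 hY du14 (e12.symm.trans e1y)

/-- HAUGLAND'S ASSEMBLY STEP, FIELD FORM: for a real field `K ∋ √3, √5`, every proper `4`-colouring of the unit-distance graph of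
`K²` has a MONOCHROMATIC pair at distance `√3`. -/
theorem exists_monochromatic_sqrt3_pair (K : IntermediateField ℚ ℝ) (h3 : Real.sqrt 3 ∈ K) (h5 : Real.sqrt 5 ∈ K)
    (C : (planeUnitDistanceGraph.induce (fieldPoints K)).Coloring (Fin 4)) :
    ∃ p q : fieldPoints K, dist (p : EuclideanSpace ℝ (Fin 2)) q = Real.sqrt 3 ∧ C p = C q := by
  by_contra hne
  push Not at hne
  exact false_of_sqrt3_pairs_bichromatic K h3 h5 C fun p q hpq => hne p q hpq

/-- Gadget form: if some argument forces EVERY `√3`-pair of `K²` to be bichromatic in 4 colours (e.g. a non-monochromatic-pair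
gadget over `K` moved around by the `K`-rational isometries), then `K²` is not `4`-colourable — for `K = ℚ(√3,√5) ⊂ ℚ₁₁` this would
give `χ(ℚ₁₁²) = 5`. -/
theorem not_colorable_four_plane_of_sqrt3_pairs_bichromatic (K : IntermediateField ℚ ℝ) (h3 : Real.sqrt 3 ∈ K)
    (h5 : Real.sqrt 5 ∈ K)
    (h : ∀ C : (planeUnitDistanceGraph.induce (fieldPoints K)).Coloring (Fin 4),
      ∀ p q : fieldPoints K, dist (p : EuclideanSpace ℝ (Fin 2)) q = Real.sqrt 3 → C p ≠ C q) :
    ¬ (planeUnitDistanceGraph.induce (fieldPoints K)).Colorable 4 := by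
  rintro ⟨C⟩
  exact false_of_sqrt3_pairs_bichromatic K h3 h5 C (h C)

end Summit.Ventures.DiscreteObjects.UnitDistance
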